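import Summits.Ventures.HodgeRepro2.T6N41TauMain
import Summits.Ventures.HodgeRepro2.T6N3Toy
import Summits.Ventures.HodgeRepro2.T6N42ToyNSide

/-!
# T6N41TauToy — non-vacuity witnesses for the τ′ layer (README §10.5(ii)(c)/(d); Tier 6, M2; proof lane; owner t6-p4)

A toy `TauDatum` on t6-p3's toy side `N3Toy.side` (`L²([H]) = L²([G]) = 𝒮 = ℂ`, `Θ φ f = φ · \overline{f}`,
`π₀ = τ′iso = ⊤`) and t6-p5's toy N4 side `N42ToyNSide.toyNSide` (two finite places with t6-p5's toy zeta data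
`R = π^∨ = π = ℂ`, `Z^*(½)(r, d, p) = r · d · p`, three real places, `S` = all places, `(H_loc)` true, `L(1) ≠ 0`,
t6-p6's toy archimedean bundle with `Z^*_{τ′_j}(½) ≠ 0`): the unramified datum `(1, 1, 1)`, `d_v = 1`, and the
assembly `x ↦ (φ₁, 1, 1, 1)` with `φ₁ := 2 · L(1) · ∏_v Z_v^*(½)(x_v) · ∏_j Z^*_{τ′_j}(½)` — so that the Rallis
formula `⟪Θ(1,1), Θ(φ₁,1)⟫ = 2 · L(1) · ∏_w loc w` is an IDENTITY on the toy's pure tensors (the product over the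
toy's five places is finite) and the unramified identity holds (`Z^*(½)(1, 1, 1) = 1 = 1⁻¹`).  Hence (c) the
carrier `TauDatum` is inhabited, (d) the two displays instantiate simultaneously with `(R1) ∧ (H_loc)`, t6-p5's
zeta form of N4.2 on the toy (`toyFinitePlaces_zetaNonzeroEverywhere`) and the archimedean non-vanishing, and
`TauDatum.hypI_of_rallis` fires, producing a lift `Θ(φ₁, 1) = φ₁ ≠ 0`.  Neither display is closed by `trivial` /
`simp` / `decide` / `exact ⟨⟩` on a general datum.  Nothing here is consumed by the M2 theorem.  §8(d): uses an
L-value-free non-vanishing device: NO.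
-/

namespace Summit.Ventures.HodgeRepro2.T6
namespace N41TauToy

open scoped InnerProductSpace
open N42ToyNSide N42Toy

/-- the toy's finite places, `Unit ⊕ Unit` (t6-p5's `toyFinitePlaces`), are a finite type (so are the toy's
places `toyNSide.Place = toyNSide.d42.Place ⊕ Fin 3`, by the instance on sums) -/
instance : Fintype toyNSide.d42.Place := inferInstanceAs (Fintype (Unit ⊕ Unit))

/-- The archimedean local factors of the toy: t6-p6's `Z^*_{τ′_j}(½)` on the toy bundle with the `L`-factors
re-pointed to the toy datum's (`withLfac`), as the τ′ layer reads them. -/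
noncomputable def zArch (j : Fin 3) : ℂ :=
  (toyNSide.d43.withLfac fun j => toyNSide.d41.Lv (Sum.inr j)).zetaStarAt j

/-- The toy assembly: the finite family `x` of local test data and the forced archimedean data give the
quadruple `(φ₁, 1, 1, 1)` with `φ₁ = 2 · L(1) · ∏_v Z_v^*(½)(x_v) · ∏_j Z^*_{τ′_j}(½)` and the local factors
`Z_v^*(½)(x_v)` / `zArch`. -/
noncomputable def assembleToy (x : ∀ v, toyNSide.LocalTest v) : PureData N3Toy.side toyNSide where
  φ₁ := 2 * toyNSide.d41.L 1 * ((∏ v, toyNSide.zvalue v (x v)) * ∏ j, zArch j)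
  φ₂ := 1
  f₁ := 1
  f₂ := 1
  loc := Sum.elim (fun v => toyNSide.zvalue v (x v)) zArch

/-- The unramified datum of the toy: `(1, 1, 1)` at every finite place (the local spaces are all `ℂ`). -/
def sphToy : ∀ v, toyNSide.LocalTest v
  | Sum.inl _ => ((1 : ℂ), (1 : ℂ), (1 : ℂ))
  | Sum.inr _ => ((1 : ℂ), (1 : ℂ), (1 : ℂ))

/-- The toy pure-tensor test datum. -/
noncomputable def toyTd : TauDatum N3Toy.side toyNSide where
  Pure := Set.range assembleToy
  sph := sphToy
  dv _ := 1
  dv_ne_zero _ _ := one_ne_zero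
  assemble := assembleToy
  assemble_pure x _ := ⟨x, rfl⟩
  assemble_loc_fin _ _ := rfl
  assemble_loc_arch _ _ := rfl
  assemble_f₁_mem _ := Submodule.mem_inf.2 ⟨Submodule.mem_top, Submodule.mem_top⟩

/-- (c) the carrier is inhabited. -/
theorem nonempty_tauDatum : Nonempty (TauDatum N3Toy.side toyNSide) := ⟨toyTd⟩

/-- The toy's theta lift of `(φ, 1)` is `φ`. -/
theorem theta_one (φ : ℂ) : N3Toy.side.Θ φ (1 : ℂ) = φ := by
  simp [N3Toy.thetaToy_apply]

/-- GQT Theorem 11.4(ii) + (11.3) hold on the toy: the product over the toy's five places is finite, and the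
assembled `φ₁` was built to make the formula an identity. -/
theorem toy_rallis : Hyp.GQT2014_Thm11_4_ii_Rallis toyTd := by
  intro _ p hp
  obtain ⟨x, rfl⟩ := (show p ∈ Set.range assembleToy from hp)
  refine ⟨(hasSum_fintype _).summable, ?_⟩
  show ⟪N3Toy.side.Θ (1 : ℂ) (1 : ℂ), N3Toy.side.Θ (assembleToy x).φ₁ (1 : ℂ)⟫_ℂ =
    2 * toyNSide.d41.L 1 * ∏' w, (assembleToy x).loc w
  rw [theta_one, theta_one, tprod_fintype, Fintype.prod_sum_type]
  simp only [assembleToy, Sum.elim_inl, Sum.elim_inr]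
  simp

/-- The toy's local value on the unramified datum is `1 · 1 · 1 = 1` at every finite place. -/
theorem zvalue_sph (v : toyNSide.d42.Place) : toyNSide.zvalue v (toyTd.sph v) = 1 := by
  cases v
  · exact (toyZeta_apply toyPair (LinearEquiv.refl ℂ ℂ) (1 / 2) 1 1 (1 : ℂ)).trans (by rw [one_mul, one_mul]; rfl)
  · exact (toyZeta_apply (toyTower.pair 1) (LinearEquiv.refl ℂ ℂ) (1 / 2) 1 1 (1 : ℂ)).trans (by rw [one_mul, one_mul]; rfl)

/-- GQT §11.6's unramified identity holds on the toy: `Z^*(½)(1, 1, 1) = 1 = 1⁻¹` (not only vacuously — the toy's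
`S` is every place). -/
theorem toy_unramified : Hyp.GQT2014_Sec11_6_Unramified toyTd :=
  fun v _ => by rw [zvalue_sph]; simp [toyTd]

/-- (d) the τ′ layer fires on the toy: hypothesis (i) of Proposition N* on the toy side from the two displays,
`(R1) ∧ (H_loc)`, t6-p5's zeta form of N4.2 on the toy and the archimedean non-vanishing of the toy N4 side. -/
theorem toy_hypI : N3Toy.side.hypI :=
  toyTd.hypI_of_rallis toy_rallis toy_unramified toyNSide_N4.1 toyFinitePlaces_zetaNonzeroEverywhere
    toyNSide_N4.2

/-- The witness the layer produces on the toy is genuinely non-zero: `φ₁ = 2 · L(1) · 1 · ∏_j Z^*_{τ′_j}(½) ≠ 0`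
for the unramified family `x = sph`. -/
theorem toy_witness_ne_zero : (assembleToy toyTd.sph).φ₁ ≠ 0 := by
  show 2 * toyNSide.d41.L 1 * ((∏ v, toyNSide.zvalue v (toyTd.sph v)) * ∏ j, zArch j) ≠ 0
  simp only [zvalue_sph, Finset.prod_const_one, one_mul]
  exact mul_ne_zero (mul_ne_zero two_ne_zero toyD41_N41.1.2)
    (Finset.prod_ne_zero_iff.2 fun j _ => toyNSide_archNonvanishing j)

end N41TauToy
end Summit.Ventures.HodgeRepro2.T6
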